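import Mathlib
import HarnessLib
import Summits.HubbardSuperconductivity.HubbardSuperconductivity.Theorems.KLProgrammeKLRegimeEngineIsoTupleV17FDoor
import Summits.HubbardSuperconductivity.HubbardSuperconductivity.Theorems.KLProgrammeKLRegimeEngineScaleZeroResummedTwoLegSums

/-!
# K3 ENGINE-FLOW child (gen 8, stmt-HubbardSuperconductivity-20437 `KLRegimeEngineV17F2`), stub (c), (E5-F)ₙ door input (II):
# a bare-ball lattice point on the zone DIAGONAL whose doubled momentum is off the pair class at every scale ≥ 1
# (cell gate-hubbard-kl, seat hubbard-kl-k3c2-p2 g8, value/(T) lane)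

The (E5-F)ₙ door `isoTupleL1AtV17F_of_fixedTuple_le_of_flowValues` (`…EngineIsoTupleV17FDoor`, p533661) reads the `↑↓` value at ONE bare-ball
triple `(q, q, q₃)` whose pair momentum `q + q₃` is off the pair class from scale `1` on (`4⁻¹ < |q + q₃|_𝕋`), so that the pp gains along the
ladder are the FROZEN ones of `GeoConsts.WF`.  Here is that datum for the Hubbard band `e(k) = −2(cos k₁ + cos k₂)` on the window
`μ ∈ klWindowC = [−1.05, −0.15]`, with `q₃ = q`: the lattice point `q = (2πk₀/L, 2πk₀/L)`, `k₀ = ⌊a·L/(2π)⌋`, under the diagonal Fermi point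
`(a, a)`, `cos a = −μ/4 ∈ [0.0375, 0.2625]` (so `1 < a < π/2`), has `|e(q) − μ| = 4|cos(2πk₀/L) − cos a| ≤ 8π/L ≤ klE0 = 1/32` once `L ≥ 2^15`
(the engine's volume threshold: `two_pow_fifteen_le_of_klEngL₃_le`), and `|2q|_𝕋 = 2·(2πk₀/L) > 2(a − 2π/L) > 1/4` (`2q` lies in `(0, π)²`,
inside the fundamental strip, far from `2πℤ²`).

* `exists_mem_klBall_zero_diag` — `∃ q ∈ klBall L μ 0, 4⁻¹ < klTorusNorm L (q + q)` for `μ ∈ klWindowC`, `2^15 ≤ L`;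
* `exists_mem_klBall_zero_diag_of_klEngL₃_le` — the same under the engine binder `klEngL₃ β U ≤ L` (`klBetaMin ≤ β`).

Elementary real analysis on the lattice momenta; nothing about the model's correlation functions is asserted; nothing asserts superconductivity.
-/

noncomputable section

namespace Summit.HubbardSuperconductivity.HubbardSuperconductivity.Theorems.KLRegimeSplit

set_option linter.dupNamespace false -- summit = problem name (single-conjunct summit), D-0017

open Real Finset Literature.MathematicalPhysics.QuantumLattice Literature.Probability.LatticeModels
open Summit.HubbardSuperconductivity.HubbardSuperconductivity.Theorems.KLProgrammeLegKernels
open Summit.HubbardSuperconductivity.HubbardSuperconductivity.Theorems.EngineV8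

/-- `|x|_𝕋 = |x|` on the fundamental strip `(−π, π]`. -/
theorem torusAbs_eq_abs_of_mem_Ioc {x : ℝ} (hx : x ∈ Set.Ioc (-Real.pi) Real.pi) : torusAbs x = |x| := by
  unfold torusAbs
  congr 1
  rw [toIocMod_eq_self]
  have : -Real.pi + 2 * Real.pi = Real.pi := by ring
  rwa [this]

/-- **A bare-ball point on the zone diagonal with doubled momentum off the pair class**: for `μ ∈ klWindowC` and `2^15 ≤ L` there is a
lattice momentum `q` with `|e(q) − μ| ≤ klE0` (`q ∈ klBall L μ 0`) and `4⁻¹ < |q + q|_𝕋`. -/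
theorem exists_mem_klBall_zero_diag {μ : ℝ} (hμ : μ ∈ klWindowC) {L : ℕ} [NeZero L] (hL : (2 : ℝ) ^ 15 ≤ L) :
    ∃ q : TorusSite 2 L, q ∈ klBall L μ 0 ∧ 4⁻¹ < klTorusNorm L (q + q) := by
  obtain ⟨hμ1, hμ2⟩ := hμ
  -- the diagonal Fermi angle `a`, `cos a = -μ/4 ∈ (0, 1/2]`
  set x : ℝ := -μ / 4 with hx
  have hx0 : 0 < x := by rw [hx]; linarith
  have hx1 : x ≤ 1 / 2 := by rw [hx]; linarith
  set a : ℝ := Real.arccos x with ha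
  have hcos : Real.cos a = x := Real.cos_arccos (by linarith) (by linarith)
  have ha0 : 0 ≤ a := Real.arccos_nonneg x
  have hapi2 : a < π / 2 := Real.arccos_lt_pi_div_two.2 hx0
  have hapi : a ≤ π := Real.arccos_le_pi x
  have ha1 : 1 < a := by
    by_contra h
    rw [not_lt] at h
    have hc : Real.cos 1 ≤ Real.cos a :=
      (Real.cos_le_cos_of_nonneg_of_le_pi ha0 (by linarith [Real.pi_gt_three]) h)
    have hc1 : 1 - (1 : ℝ) ^ 2 / 2 ≤ Real.cos 1 := Real.one_sub_sq_div_two_le_cos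
    rw [hcos] at hc
    linarith
  -- volume facts
  have hL0 : (0 : ℝ) < L := lt_of_lt_of_le (by norm_num) hL
  have hπ := Real.pi_pos
  have hπ3 := Real.pi_gt_three
  have hπ4 := Real.pi_lt_four
  -- the lattice index under `a`
  set k₀ : ℕ := ⌊a * L / (2 * π)⌋₊ with hk₀
  have hk₀le : (k₀ : ℝ) ≤ a * L / (2 * π) := Nat.floor_le (by positivity)
  have hk₀gt : a * L / (2 * π) < k₀ + 1 := Nat.lt_floor_add_one _
  set p : ℝ := 2 * π * k₀ / L with hp
  have hp_le : p ≤ a := by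
    rw [hp]
    have := mul_le_mul_of_nonneg_left hk₀le (by positivity : (0 : ℝ) ≤ 2 * π / L)
    calc 2 * π * k₀ / L = 2 * π / L * k₀ := by ring
      _ ≤ 2 * π / L * (a * L / (2 * π)) := this
      _ = a := by field_simp
  have hp_gt : a - 2 * π / L < p := by
    rw [hp]
    have := mul_lt_mul_of_pos_left hk₀gt (by positivity : (0 : ℝ) < 2 * π / L)
    have h2 : 2 * π / L * (a * L / (2 * π)) = a := by field_simp
    rw [h2] at this
    have h3 : 2 * π / L * ((k₀ : ℝ) + 1) = 2 * π * k₀ / L + 2 * π / L := by ring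
    linarith
  have hp0 : 0 ≤ p := by rw [hp]; positivity
  have h2πL : 2 * π / L ≤ 1 / 4 := by
    rw [div_le_iff₀ hL0]; nlinarith
  -- `k₀ < L` and `2 k₀ < L`
  have h2k₀ : 2 * k₀ < L := by
    have h1 : (2 * k₀ : ℝ) < L := by
      have : (k₀ : ℝ) ≤ a * L / (2 * π) := hk₀le
      have h2 : a * L / (2 * π) < L / 2 := by
        rw [div_lt_div_iff₀ (by positivity) (by norm_num)]
        nlinarith
      linarith
    exact_mod_cast h1
  have hk₀L : k₀ < L := by omega
  -- the point
  refine ⟨fun _ => (k₀ : ZMod L), ?_, ?_⟩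
  · -- membership in the bare ball: `|e(q) − μ| ≤ klE0`
    have hlm : ∀ i : Fin 2, latticeMomentum L (fun _ : Fin 2 => (k₀ : ZMod L)) i = p := by
      intro i
      simp only [latticeMomentum, ZMod.val_cast_of_lt hk₀L, hp]
    rw [klBall, klShell, mem_momentumShell, nambuXiCT_zero_frame]
    simp only [nambuXi, torusBand, hlm, Fin.sum_univ_two, klScale, pow_zero, inv_one, mul_one]
    have hμ4 : μ = -4 * Real.cos a := by rw [hcos, hx]; ring
    rw [hμ4]
    have hcc : |Real.cos p - Real.cos a| ≤ |p - a| := Real.abs_cos_sub_cos_le p a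
    have hpa : |p - a| ≤ 2 * π / L := by
      rw [abs_sub_comm, abs_of_nonneg (by linarith)]
      linarith
    have hE : 4 * (2 * π / L) ≤ klE0 := by
      rw [klE0]
      calc 4 * (2 * π / L) = 8 * π / L := by ring
        _ ≤ 8 * π / 2 ^ 15 := by
            apply div_le_div_of_nonneg_left (by positivity) (by positivity) hL
        _ ≤ 1 / 32 := by rw [div_le_iff₀ (by positivity)]; nlinarith
    calc |-2 * (Real.cos p + Real.cos p) - -4 * Real.cos a| = 4 * |Real.cos p - Real.cos a| := by
          rw [show -2 * (Real.cos p + Real.cos p) - -4 * Real.cos a = 4 * (Real.cos a - Real.cos p) by ring, abs_mul,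
            abs_of_pos (by norm_num : (0 : ℝ) < 4), abs_sub_comm]
      _ ≤ 4 * (2 * π / L) := by nlinarith [hcc.trans hpa, abs_nonneg (Real.cos p - Real.cos a)]
      _ ≤ klE0 := hE
  · -- the doubled momentum is off the pair class: `|2q|_𝕋 = 2p > 1/4`
    have hval2 : ((k₀ : ZMod L) + (k₀ : ZMod L)).val = 2 * k₀ := by
      rw [← Nat.cast_add, ZMod.val_cast_of_lt (by omega)]; ring
    have hlm2 : ∀ i : Fin 2, latticeMomentum L ((fun _ : Fin 2 => (k₀ : ZMod L)) + fun _ : Fin 2 => (k₀ : ZMod L)) i = 2 * p := by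
      intro i
      simp only [latticeMomentum, Pi.add_apply, hval2, hp]
      push_cast
      ring
    have h2p : 2 * p ∈ Set.Ioc (-Real.pi) Real.pi := by
      constructor
      · linarith
      · linarith
    rw [klTorusNorm, torusSupNorm, hlm2 0, hlm2 1, max_self, torusAbs_eq_abs_of_mem_Ioc h2p, abs_of_nonneg (by linarith)]
    linarith

/-- **The same under the engine's volume binder** `klEngL₃ β U ≤ L` (`klBetaMin ≤ β`). -/
theorem exists_mem_klBall_zero_diag_of_klEngL₃_le {μ : ℝ} (hμ : μ ∈ klWindowC) {β U : ℝ} (hβ : klBetaMin ≤ β) {L : ℕ} [NeZero L]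
    (hL : klEngL₃ β U ≤ L) : ∃ q : TorusSite 2 L, q ∈ klBall L μ 0 ∧ 4⁻¹ < klTorusNorm L (q + q) :=
  exists_mem_klBall_zero_diag hμ (two_pow_fifteen_le_of_klEngL₃_le hβ hL)

end Summit.HubbardSuperconductivity.HubbardSuperconductivity.Theorems.KLRegimeSplit

end
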